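import Mathlib
import HarnessLib
import Summits.HubbardSuperconductivity.HubbardSuperconductivity.Theses.ChiralWindow
import Summits.HubbardSuperconductivity.HubbardSuperconductivity.Theorems.ChiralWindowCwKLChiralWindowReduction
import Summits.HubbardSuperconductivity.HubbardSuperconductivity.Theorems.ChiralWindowCwKLChiralWindowFrameHS
import Summits.HubbardSuperconductivity.HubbardSuperconductivity.Theorems.ChiralWindowCwKLChiralWindowKernelHS

/-!
# Crux `CwKLChiralWindow` (stmt-HubbardSuperconductivity-1741): the crux from the `U = 1` certificate ALONE

Route `HubbardSuperconductivity/ChiralWindow`, line `Sketch` (lead seat …-1741-c1-0).  The earlier reduction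
`cwKLChiralWindow_of_certificate` (…Reduction.lean) needed, besides the numerical certificate (C), an `L^∞` bound (B) on the
Lindhard kernel `χ₀(k+k')` over `F_δ × F_δ`.  The frame only ever uses that `Q(ψ) = ∫∫ ψ(k) χ₀(k+k') ψ(k') dσ dσ` is a bounded
quadratic form on `L²(σ_δ)`, which follows from the HILBERT–SCHMIDT property of the kernel — now a theorem of the tree:
`stub_klKernelHS` (…KernelHS.lean, from `Literature…memLp_lindhardKernelPolar` and the torus-sublevel / shell-volume
estimates landed for item 1744) and the splitting / HS bound `stub_klFrameHS` (…FrameHS.lean).  This file derives the three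
frame consequences — `U²`-homogeneity of the pairing form on mean-zero gap functions and of the channel bottom off `A1g`,
and the bare-`U` penalty `U² Λ₁(χ) ≤ Λ_U(χ)` for `0 < U ≤ 1` — WITHOUT hypothesis (B), and concludes

* `cwKLChiralWindow_of_certificateHS : (C) → CwKLChiralWindow` (with `U₁ = 1`),

so the crux is closed modulo the single numerical statement (C) (certified interval computation; specification
`Cruxes/CwKLChiralWindow/CertSpec.md`, rigorous Lindhard engine `CertEngine.md`).
References: S. Raghu, S. A. Kivelson, D. J. Scalapino, Phys. Rev. B 81 (2010) 224505 (arXiv:1002.0591) §II (7), (13).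
-/

noncomputable section

set_option linter.dupNamespace false

namespace Summit.HubbardSuperconductivity.HubbardSuperconductivity.Theorems

open MeasureTheory Literature.MathematicalPhysics.QuantumLattice
open Summit.HubbardSuperconductivity.HubbardSuperconductivity.Theses.ChiralWindow
open scoped Pointwise

/-! ### Frame consequences (sorry-free) -/

section Frame

variable {μ : ℝ}

/-- **`U²`-homogeneity of the pairing form on mean-zero `L²` gap functions** (from (K), (F)). [folklore] -/
theorem klhs_pairingForm_sq (hK : ∀ μ ∈ Set.Ioo (-4 : ℝ) 0,
      MemLp (fun z : Momentum × Momentum => lindhardFunction (squareDispersion 1 0) μ (z.1 + z.2)) 2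
        ((fermiCurveMeasure (squareDispersion 1 0) μ).prod (fermiCurveMeasure (squareDispersion 1 0) μ)))
    (hμ : μ ∈ Set.Ioo (-4 : ℝ) 0) (U : ℝ) {ψ : Momentum → ℝ}
    (hψ : MemLp ψ 2 (fermiCurveMeasure (squareDispersion 1 0) μ))
    (h0 : ∫ k, ψ k ∂fermiCurveMeasure (squareDispersion 1 0) μ = 0) :
    pairingForm (squareDispersion 1 0) μ U ψ = U ^ 2 * pairingForm (squareDispersion 1 0) μ 1 ψ := by
  rw [(stub_klFrameHS hK μ hμ U ψ hψ).1, (stub_klFrameHS hK μ hμ 1 ψ hψ).1, h0]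
  ring

/-- **`U²`-homogeneity of the channel bottom off `A1g`** (from (K), (F) and mean zero). [folklore] -/
theorem klhs_channelInf_sq (hK : ∀ μ ∈ Set.Ioo (-4 : ℝ) 0,
      MemLp (fun z : Momentum × Momentum => lindhardFunction (squareDispersion 1 0) μ (z.1 + z.2)) 2
        ((fermiCurveMeasure (squareDispersion 1 0) μ).prod (fermiCurveMeasure (squareDispersion 1 0) μ)))
    (hμ : μ ∈ Set.Ioo (-4 : ℝ) 0) (U : ℝ) (χ : D4Irrep)
    (hmean : ∀ ψ, IsChannelState (squareDispersion 1 0) μ χ ψ →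
      ∫ k, ψ k ∂fermiCurveMeasure (squareDispersion 1 0) μ = 0) :
    channelInf (squareDispersion 1 0) μ U χ = U ^ 2 * channelInf (squareDispersion 1 0) μ 1 χ := by
  unfold channelInf
  have himg : (pairingForm (squareDispersion 1 0) μ U) '' {ψ | IsChannelState (squareDispersion 1 0) μ χ ψ}
      = (U ^ 2) • ((pairingForm (squareDispersion 1 0) μ 1) ''
          {ψ | IsChannelState (squareDispersion 1 0) μ χ ψ}) := by
    rw [← Set.image_smul, Set.image_image]
    apply Set.image_congr
    intro ψ hψ
    show pairingForm (squareDispersion 1 0) μ U ψ = U ^ 2 • pairingForm (squareDispersion 1 0) μ 1 ψ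
    rw [klhs_pairingForm_sq hK hμ U hψ.1 (hmean ψ hψ), smul_eq_mul]
  rw [himg, Real.sInf_smul_of_nonneg (sq_nonneg U), smul_eq_mul]

/-- **The bare-`U` penalty** for `0 < U ≤ 1` and any channel (from (K), (F)): `U² Λ₁(χ) ≤ Λ_U(χ)`. [folklore] -/
theorem klhs_sq_channelInf_one_le (hK : ∀ μ ∈ Set.Ioo (-4 : ℝ) 0,
      MemLp (fun z : Momentum × Momentum => lindhardFunction (squareDispersion 1 0) μ (z.1 + z.2)) 2
        ((fermiCurveMeasure (squareDispersion 1 0) μ).prod (fermiCurveMeasure (squareDispersion 1 0) μ)))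
    (hμ : μ ∈ Set.Ioo (-4 : ℝ) 0) {U : ℝ} (hU0 : 0 < U) (hU1 : U ≤ 1) (χ : D4Irrep) :
    U ^ 2 * channelInf (squareDispersion 1 0) μ 1 χ ≤ channelInf (squareDispersion 1 0) μ U χ := by
  unfold channelInf
  set S := {ψ | IsChannelState (squareDispersion 1 0) μ χ ψ} with hS
  set H : ℝ := Real.sqrt (∫ z, (lindhardFunction (squareDispersion 1 0) μ (z.1 + z.2)) ^ 2
      ∂(fermiCurveMeasure (squareDispersion 1 0) μ).prod (fermiCurveMeasure (squareDispersion 1 0) μ)) with hH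
  rcases (pairingForm (squareDispersion 1 0) μ U '' S).eq_empty_or_nonempty with hSe | hSne
  · have hSe' : pairingForm (squareDispersion 1 0) μ 1 '' S = ∅ := by
      rw [Set.image_eq_empty] at hSe ⊢; exact hSe
    rw [hSe, hSe', Real.sInf_empty, mul_zero]
  · have hbb : BddBelow (pairingForm (squareDispersion 1 0) μ 1 '' S) := by
      refine ⟨-H, ?_⟩
      rintro x ⟨ψ, hψ, rfl⟩
      obtain ⟨hsplit, hbd⟩ := stub_klFrameHS hK μ hμ 1 ψ hψ.1
      rw [hsplit, hψ.2.1, one_mul] at *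
      have := neg_abs_le (∫ k, ψ k * ∫ k', lindhardFunction (squareDispersion 1 0) μ (k + k') * ψ k'
            ∂fermiCurveMeasure (squareDispersion 1 0) μ ∂fermiCurveMeasure (squareDispersion 1 0) μ)
      nlinarith [sq_nonneg (∫ k, ψ k ∂fermiCurveMeasure (squareDispersion 1 0) μ)]
    refine le_csInf hSne ?_
    rintro x ⟨ψ, hψ, rfl⟩
    have hle : sInf (pairingForm (squareDispersion 1 0) μ 1 '' S) ≤ pairingForm (squareDispersion 1 0) μ 1 ψ :=
      csInf_le hbb ⟨ψ, hψ, rfl⟩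
    have hUU : U ^ 2 ≤ U := by nlinarith
    obtain ⟨hU', _⟩ := stub_klFrameHS hK μ hμ U ψ hψ.1
    obtain ⟨h1', _⟩ := stub_klFrameHS hK μ hμ 1 ψ hψ.1
    rw [hU']
    rw [h1'] at hle
    have hI := sq_nonneg (∫ k, ψ k ∂fermiCurveMeasure (squareDispersion 1 0) μ)
    have h1 := mul_le_mul_of_nonneg_left hle (sq_nonneg U)
    nlinarith [mul_le_mul_of_nonneg_right hUU hI]

end Frame

/-! ### The crux from the certificate -/

/-- **`CwKLChiralWindow` from the `U = 1` certificate** (partner `χs ∉ {B1g, A2g, A1g}`, window `[a,b] ⊆ [3/10,12/25]`,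
margins `γ, c > 0`, clauses (i)–(iv) for `Λ₁ = channelInf … 1`): the crux holds with the same data and `U₁ = 1`.
[cite: RaghuKivelsonScalapino2010, §II (7) and (13)] -/
theorem cwKLChiralWindow_of_certificateHS :
    (∃ χs : D4Irrep, χs ≠ D4Irrep.B1g ∧ χs ≠ D4Irrep.A2g ∧ χs ≠ D4Irrep.A1g ∧
    ∃ a b γ c : ℝ, 3/10 ≤ a ∧ a < b ∧ b ≤ 12/25 ∧ 0 < γ ∧ 0 < c ∧
    (∀ χ, χ ≠ D4Irrep.B1g →
      channelInf (squareDispersion 1 0) (chemicalPotentialOfDensity (squareDispersion 1 0) (1 - a)) 1 D4Irrep.B1g + γ ≤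
        channelInf (squareDispersion 1 0) (chemicalPotentialOfDensity (squareDispersion 1 0) (1 - a)) 1 χ) ∧
    (∀ χ, χ ≠ χs →
      channelInf (squareDispersion 1 0) (chemicalPotentialOfDensity (squareDispersion 1 0) (1 - b)) 1 χs + γ ≤
        channelInf (squareDispersion 1 0) (chemicalPotentialOfDensity (squareDispersion 1 0) (1 - b)) 1 χ) ∧
    (∀ δ ∈ Set.Icc a b, ∀ χ, χ ≠ D4Irrep.B1g → χ ≠ χs →
      min (channelInf (squareDispersion 1 0) (chemicalPotentialOfDensity (squareDispersion 1 0) (1 - δ)) 1 D4Irrep.B1g)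
          (channelInf (squareDispersion 1 0) (chemicalPotentialOfDensity (squareDispersion 1 0) (1 - δ)) 1 χs) + γ ≤
        channelInf (squareDispersion 1 0) (chemicalPotentialOfDensity (squareDispersion 1 0) (1 - δ)) 1 χ) ∧
    (∀ δ ∈ Set.Icc a b, ∃ (g : Momentum → ℝ) (n : ℕ) (f : Fin n → Momentum → ℝ),
      IsChannelState (squareDispersion 1 0) (chemicalPotentialOfDensity (squareDispersion 1 0) (1 - δ)) D4Irrep.B1g g ∧
      pairingForm (squareDispersion 1 0) (chemicalPotentialOfDensity (squareDispersion 1 0) (1 - δ)) 1 g =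
        channelInf (squareDispersion 1 0) (chemicalPotentialOfDensity (squareDispersion 1 0) (1 - δ)) 1 D4Irrep.B1g ∧
      (∀ i, IsChannelState (squareDispersion 1 0) (chemicalPotentialOfDensity (squareDispersion 1 0) (1 - δ)) χs (f i) ∧
        pairingForm (squareDispersion 1 0) (chemicalPotentialOfDensity (squareDispersion 1 0) (1 - δ)) 1 (f i) =
          channelInf (squareDispersion 1 0) (chemicalPotentialOfDensity (squareDispersion 1 0) (1 - δ)) 1 χs) ∧
      (Pairwise fun i j => ∫ k, f i k * f j k
        ∂fermiCurveMeasure (squareDispersion 1 0) (chemicalPotentialOfDensity (squareDispersion 1 0) (1 - δ)) = 0) ∧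
      ∀ᵐ k ∂fermiCurveMeasure (squareDispersion 1 0) (chemicalPotentialOfDensity (squareDispersion 1 0) (1 - δ)),
        c ≤ g k ^ 2 + ∑ i, f i k ^ 2) ) →
    CwKLChiralWindow := by
  intro hC
  have hK := stub_klKernelHS
  obtain ⟨χs, hsB1, hsA2, hsA1, a, b, γ, c, ha, hab, hb, hγ, hc, hi, hii, hiii, hiv⟩ := hC
  have hwin : ∀ δ ∈ Set.Icc a b, δ ∈ Set.Icc (3/10:ℝ) (12/25) :=
    fun δ hδ => ⟨le_trans ha hδ.1, le_trans hδ.2 hb⟩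
  have hμ : ∀ δ ∈ Set.Icc a b,
      chemicalPotentialOfDensity (squareDispersion 1 0) (1 - δ) ∈ Set.Ioo (-4:ℝ) 0 :=
    fun δ hδ => stub_klMuWindow δ (hwin δ hδ)
  have hfin : ∀ δ ∈ Set.Icc a b, IsFiniteMeasure
      (fermiCurveMeasure (squareDispersion 1 0) (chemicalPotentialOfDensity (squareDispersion 1 0) (1 - δ))) :=
    fun δ hδ => stub_klFiniteMeasure stub_klGradient stub_klHausdorffFinite _ (hμ δ hδ)
  have hinv : ∀ δ ∈ Set.Icc a b, ∀ γ' : DihedralGroup 4, MeasurePreserving (d4Momentum γ')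
      (fermiCurveMeasure (squareDispersion 1 0) (chemicalPotentialOfDensity (squareDispersion 1 0) (1 - δ)))
      (fermiCurveMeasure (squareDispersion 1 0) (chemicalPotentialOfDensity (squareDispersion 1 0) (1 - δ))) :=
    fun δ hδ => stub_klD4Invariant stub_klGradient _ (hμ δ hδ)
  have hmean : ∀ δ ∈ Set.Icc a b, ∀ (χ : D4Irrep) (ψ : Momentum → ℝ), χ ≠ D4Irrep.A1g →
      IsChannelState (squareDispersion 1 0) (chemicalPotentialOfDensity (squareDispersion 1 0) (1 - δ)) χ ψ →
      ∫ k, ψ k ∂fermiCurveMeasure (squareDispersion 1 0)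
        (chemicalPotentialOfDensity (squareDispersion 1 0) (1 - δ)) = 0 :=
    fun δ hδ χ ψ hχ hψ => (stub_klMeanZero _ _ (hfin δ hδ) (hinv δ hδ) χ ψ hχ hψ).2
  have hhom : ∀ δ ∈ Set.Icc a b, ∀ (U : ℝ) (χ : D4Irrep), χ ≠ D4Irrep.A1g →
      channelInf (squareDispersion 1 0) (chemicalPotentialOfDensity (squareDispersion 1 0) (1 - δ)) U χ =
        U ^ 2 * channelInf (squareDispersion 1 0) (chemicalPotentialOfDensity (squareDispersion 1 0) (1 - δ)) 1 χ :=
    fun δ hδ U χ hχ => klhs_channelInf_sq hK (hμ δ hδ) U χ (fun ψ hψ => hmean δ hδ χ ψ hχ hψ)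
  have hpen : ∀ δ ∈ Set.Icc a b, ∀ U ∈ Set.Ioo (0:ℝ) 1, ∀ χ : D4Irrep,
      U ^ 2 * channelInf (squareDispersion 1 0) (chemicalPotentialOfDensity (squareDispersion 1 0) (1 - δ)) 1 χ ≤
        channelInf (squareDispersion 1 0) (chemicalPotentialOfDensity (squareDispersion 1 0) (1 - δ)) U χ :=
    fun δ hδ U hU χ => klhs_sq_channelInf_one_le hK (hμ δ hδ) hU.1 hU.2.le χ
  have hform : ∀ δ ∈ Set.Icc a b, ∀ (U : ℝ) (χ : D4Irrep) (ψ : Momentum → ℝ), χ ≠ D4Irrep.A1g →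
      IsChannelState (squareDispersion 1 0) (chemicalPotentialOfDensity (squareDispersion 1 0) (1 - δ)) χ ψ →
      pairingForm (squareDispersion 1 0) (chemicalPotentialOfDensity (squareDispersion 1 0) (1 - δ)) U ψ =
        U ^ 2 * pairingForm (squareDispersion 1 0) (chemicalPotentialOfDensity (squareDispersion 1 0) (1 - δ)) 1 ψ :=
    fun δ hδ U χ ψ hχ hψ => klhs_pairingForm_sq hK (hμ δ hδ) U hψ.1 (hmean δ hδ χ ψ hχ hψ)
  have haI : a ∈ Set.Icc a b := Set.left_mem_Icc.2 hab.le
  have hbI : b ∈ Set.Icc a b := Set.right_mem_Icc.2 hab.le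
  refine ⟨χs, hsB1, hsA2, a, b, γ, c, 1, ha, hab, hb, hγ, hc, one_pos, ?_⟩
  intro U hU
  have hU2 : 0 ≤ U ^ 2 := sq_nonneg U
  refine ⟨?_, ?_, ?_, ?_⟩
  · intro χ hχ
    show channelInf (squareDispersion 1 0) (chemicalPotentialOfDensity (squareDispersion 1 0) (1 - a)) U
        D4Irrep.B1g + γ * U ^ 2 ≤
      channelInf (squareDispersion 1 0) (chemicalPotentialOfDensity (squareDispersion 1 0) (1 - a)) U χ
    rw [hhom a haI U D4Irrep.B1g (by decide)]
    have h1 := mul_le_mul_of_nonneg_left (hi χ hχ) hU2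
    have h2 := hpen a haI U hU χ
    nlinarith
  · intro χ hχ
    show channelInf (squareDispersion 1 0) (chemicalPotentialOfDensity (squareDispersion 1 0) (1 - b)) U χs
        + γ * U ^ 2 ≤
      channelInf (squareDispersion 1 0) (chemicalPotentialOfDensity (squareDispersion 1 0) (1 - b)) U χ
    rw [hhom b hbI U χs hsA1]
    have h1 := mul_le_mul_of_nonneg_left (hii χ hχ) hU2
    have h2 := hpen b hbI U hU χ
    nlinarith
  · intro δ hδ χ hχ1 hχ2
    show min (channelInf (squareDispersion 1 0) (chemicalPotentialOfDensity (squareDispersion 1 0) (1 - δ)) U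
          D4Irrep.B1g)
        (channelInf (squareDispersion 1 0) (chemicalPotentialOfDensity (squareDispersion 1 0) (1 - δ)) U χs)
        + γ * U ^ 2 ≤
      channelInf (squareDispersion 1 0) (chemicalPotentialOfDensity (squareDispersion 1 0) (1 - δ)) U χ
    rw [hhom δ hδ U D4Irrep.B1g (by decide), hhom δ hδ U χs hsA1]
    have h1 := mul_le_mul_of_nonneg_left (hiii δ hδ χ hχ1 hχ2) hU2
    have h2 := hpen δ hδ U hU χ
    have h3 := kl_min_mul_le (U ^ 2) (channelInf (squareDispersion 1 0)
      (chemicalPotentialOfDensity (squareDispersion 1 0) (1 - δ)) 1 D4Irrep.B1g)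
      (channelInf (squareDispersion 1 0)
      (chemicalPotentialOfDensity (squareDispersion 1 0) (1 - δ)) 1 χs)
    nlinarith
  · intro δ hδ
    obtain ⟨g, n, f, hg, hgval, hf, horth, hcov⟩ := hiv δ hδ
    refine ⟨g, n, f, hg, ?_, fun i => ⟨(hf i).1, ?_⟩, horth, hcov⟩
    · show pairingForm (squareDispersion 1 0) (chemicalPotentialOfDensity (squareDispersion 1 0) (1 - δ)) U g =
        channelInf (squareDispersion 1 0) (chemicalPotentialOfDensity (squareDispersion 1 0) (1 - δ)) U D4Irrep.B1g
      rw [hform δ hδ U D4Irrep.B1g g (by decide) hg, hgval, hhom δ hδ U D4Irrep.B1g (by decide)]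
    · show pairingForm (squareDispersion 1 0) (chemicalPotentialOfDensity (squareDispersion 1 0) (1 - δ)) U (f i) =
        channelInf (squareDispersion 1 0) (chemicalPotentialOfDensity (squareDispersion 1 0) (1 - δ)) U χs
      rw [hform δ hδ U χs (f i) hsA1 (hf i).1, (hf i).2, hhom δ hδ U χs hsA1]

end Summit.HubbardSuperconductivity.HubbardSuperconductivity.Theorems

end
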